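import Literature.NumberTheory.Sieve.CubicMinorantDefs
import Literature.NumberTheory.Sieve.CircleMethod
import Mathlib.MeasureTheory.Integral.IntervalIntegral.Basic
import Mathlib.Analysis.SpecialFunctions.Pow.Real
import Literature.NumberTheory.Waring.HuaLemmaCubes
import Mathlib.MeasureTheory.Integral.IntervalIntegral.Periodic
import Mathlib.Analysis.SpecialFunctions.Pow.Asymptotics
import HarnessLib

/-!
# The fourth moment of the Heath-Brown weight's exponential sum from Hua's lemma, PROVED

Topic `Literature/NumberTheory/Sieve`, namespace `Literature.NumberTheory.Sieve.CubicMinorant` (objects: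
the Heath-Brown box `hbX N = (N/6)^{1/3}`, `hbEta c N = (log X)^{−c}`, the representation count `hbRep`
and the weight `f₃ = hbWeight` with exponential sum `hbExpSum`, all the tree's `CubicMinorantDefs.lean`;
Hua's eighth moment with logarithms `HuaCubes.HuaEighthMomentLog`, PROVED in the tree as
`HuaCubes.huaEighthMomentLog_holds`, `Literature/NumberTheory/Waring/HuaLemmaCubes.lean`).

Statement `HBFourierFourthMoment` (verbatim the parity-ideate cell's Line-E/F support item E4b):
`∫₀¹ |f̂₃(α)|⁴ dα ≤ c₁ N³ (log N)^C` for `N ≥ 3` — the `L⁴` (restriction-type) bound for the weight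
counting Heath-Brown's prime values of `x³ + 2y³` in the box `X < x, y ≤ X(1+η)` — and its PROOF from
Hua's lemma by the MAJORANT PRINCIPLE [Montgomery1994, Ch. 7]: `∫|f̂|⁴ = ∑_m (f∗f)(m)²`
(`fourthMoment_eq`, Parseval), so `0 ≤ f ≤ g ⇒ ∫|f̂|⁴ ≤ ∫|ĝ|⁴` (`fourthMoment_mono`); the Heath-Brown
pairs are majorised by ALL pairs of the box, whose generating function factorises as
`r̂₀(α) = T(α)T(2α)` with `T = HuaCubes.cubicWeylSum` the cubic Weyl sum (`expSumOf_boxRep`); then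
`∫₀¹|T(α)T(2α)|⁴ ≤ ∫₀¹|T|⁸` (AM–GM and the substitution `α ↦ 2α`, `integral_norm_mul_pow_four_le`) and
Hua's eighth-moment bound `∫₀¹|T|⁸ ≪ P⁵(log P)^C` [Vaughan1997, Lemma 2.5]. Hence
`hbFourthMomentReduction_holds : HuaEighthMomentLog → HBFourierFourthMoment` and, with the tree's Hua,
`hbFourierFourthMoment_holds`. Also: `tendsto_hbX`, `tendsto_hbEta` (the box grows, its width tends to `0`).

Provenance: text = section "FourthMomentReduction" (+ two box lemmas of section "MainTermProof") of the
cell evidence file `run/shared/lean/pub/parity-ideate/parity-ideate-p2/evidence/LineEFG_tree.lean`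
(planner seat p2, 2026-08-25, sha256 f7029116…, refereed PASS—KERNEL; statements unchanged, helpers
privatised, tags added), landed by the cell's literature seat. Self-contained (a private copy of Parseval,
whose public home is `TernaryHolderCounting.lean`).

## References
* [Montgomery1994] H. L. Montgomery, *Ten Lectures on the Interface between Analytic Number Theory and
  Harmonic Analysis*, CBMS 84, AMS 1994, Chapter 7 §3 (majorant principles).
* [Vaughan1997] R. C. Vaughan, *The Hardy–Littlewood method*, 2nd ed., CUP 1997, §2.1, Lemma 2.5 (Hua).
* [HeathBrownActa2001] D. R. Heath-Brown, *Primes represented by x³ + 2y³*, Acta Math. 186 (2001) 1–84,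
  Theorem 1.
-/

noncomputable section

open scoped FourierTransform ArithmeticFunction Topology
open Finset MeasureTheory Filter Literature.NumberTheory.Sieve Literature.NumberTheory.Sieve.CubicPrimes
open Literature.NumberTheory.Waring.HuaCubes

namespace Literature.NumberTheory.Sieve.CubicMinorant

/-! ### The statements (verbatim the cell's blocks E4b and "E4 reduction") -/

/-- **The `L⁴` restriction bound for the Heath-Brown weight** (statement; PROVED below as
`hbFourierFourthMoment_holds`): `∫₀¹ |f̂₃|⁴ ≤ c₁ N³ (log N)^C`, i.e. `‖f̂₃‖₄ ≪ N^{3/4}(log N)^{C/4}`.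
Verbatim the cell's support item E4b. [cite: Vaughan1997, Lemma 2.5 (Hua's lemma) and §2.1 (the generating function of k-th powers)] -/
def HBFourierFourthMoment : Prop :=
  ∀ c : ℝ, 0 < c → ∃ C c₁ : ℝ, ∀ N : ℕ, 3 ≤ N →
    ∫ α in (0 : ℝ)..1, ‖hbExpSum c N α‖ ^ 4 ≤ c₁ * (N : ℝ) ^ 3 * Real.log N ^ C

/-- **Hua-with-logs gives the restriction bound** (statement; PROVED below as
`hbFourthMomentReduction_holds`). [cite: Montgomery1994, Chapter 7 §3 (the majorant principle for even moments of exponential sums)] -/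
def HBFourthMomentReduction : Prop := HuaEighthMomentLog → HBFourierFourthMoment

/-! ### The Heath-Brown box grows and its relative width tends to zero -/

/-- `X = (N/6)^{1/3} ≥ 0`. [cite: HeathBrownActa2001, Theorem 1 (the box X < x, y ≤ X(1+η))] -/
theorem hbX_nonneg (N : ℕ) : 0 ≤ hbX N := Real.rpow_nonneg (by positivity) _

/-- `X = (N/6)^{1/3} → ∞`. [cite: HeathBrownActa2001, Theorem 1 (the box X < x, y ≤ X(1+η))] -/
theorem tendsto_hbX : Tendsto (fun N : ℕ => hbX N) atTop atTop := by
  unfold hbX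
  exact (tendsto_rpow_atTop (by norm_num : (0 : ℝ) < 1 / 3)).comp
    ((tendsto_natCast_atTop_atTop (R := ℝ)).atTop_div_const (by norm_num : (0 : ℝ) < 6))

/-- `η = (log X)^{−c} → 0`. [cite: HeathBrownActa2001, Theorem 1 (the box X < x, y ≤ X(1+η) with η = (log X)^{-c})] -/
theorem tendsto_hbEta {c : ℝ} (hc : 0 < c) : Tendsto (fun N : ℕ => hbEta c N) atTop (𝓝 0) := by
  unfold hbEta
  exact (tendsto_rpow_neg_atTop hc).comp (Real.tendsto_log_atTop.comp tendsto_hbX)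

/-- `X > 1`, `0 < log X ≤ log N` for `N > 6`. [cite: HeathBrownActa2001, Theorem 1 (the box X < x, y ≤ X(1+η))] -/
theorem hbX_facts {N : ℕ} (hN : 6 < N) :
    1 < hbX N ∧ 0 < Real.log (hbX N) ∧ Real.log (hbX N) ≤ Real.log N := by
  have hN6 : (6 : ℝ) < N := by exact_mod_cast hN
  have hdiv : (1 : ℝ) < (N : ℝ) / 6 := by rw [lt_div_iff₀ (by norm_num)]; linarith
  have hX1 : 1 < hbX N := Real.one_lt_rpow hdiv (by norm_num)
  have hLX : 0 < Real.log (hbX N) := Real.log_pos hX1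
  refine ⟨hX1, hLX, ?_⟩
  unfold hbX
  rw [Real.log_rpow (by positivity)]
  have h1 : Real.log ((N : ℝ) / 6) ≤ Real.log N :=
    Real.log_le_log (by positivity) (by linarith)
  have h2 : 0 ≤ Real.log ((N : ℝ) / 6) := Real.log_nonneg hdiv.le
  linarith

/-- `X³ = N/6`. [cite: HeathBrownActa2001, Theorem 1 (the box X < x, y ≤ X(1+η))] -/
theorem hbX_pow_three (N : ℕ) : hbX N ^ 3 = (N : ℝ) / 6 := by
  unfold hbX
  rw [← Real.rpow_natCast, ← Real.rpow_mul (by positivity)]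
  norm_num

/-- `∑_{n ≤ N} f₃(n) e(nα) = f̂₃(α)` (`hbWeight` vanishes at `0`; private helper). [folklore] -/
private theorem expSumOf_hbWeight (c : ℝ) (N : ℕ) (α : ℝ) :
    expSumOf (hbWeight c N) N α = hbExpSum c N α := by
  unfold expSumOf hbExpSum
  have hI : Ico (0 + 1) (N + 1) = Icc 1 N := by
    ext n; simp only [mem_Ico, mem_Icc]; omega
  rw [Finset.range_eq_Ico, Finset.sum_eq_sum_Ico_succ_bot (Nat.succ_pos N), hI]
  simp [hbWeight]

/-- `log m ≤ log N` for naturals `m ≤ N` (private helper). [folklore] -/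
private theorem log_natCast_le_of_le {m N : ℕ} (h : m ≤ N) : Real.log m ≤ Real.log N := by
  rcases Nat.eq_zero_or_pos m with rfl | hm
  · simp [Real.log_natCast_nonneg]
  · exact Real.log_le_log (by exact_mod_cast hm) (by exact_mod_cast h)

/-- `|f̂(α)|² = ∑_{n,m} f(n)f(m) e((n−m)α)` (private helper for Parseval). [folklore] -/
private theorem norm_sq_expSumOf_eq_aux (f : ℕ → ℝ) (N : ℕ) (α : ℝ) :
    ((‖expSumOf f N α‖ ^ 2 : ℝ) : ℂ) =
      ∑ n ∈ range (N + 1), ∑ m ∈ range (N + 1),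
        ((f n * f m : ℝ) : ℂ) * (𝐞 ((((n : ℤ) - m : ℤ) : ℝ) * α) : ℂ) := by
  rw [expSumOf, ← Complex.normSq_eq_norm_sq, ← Complex.mul_conj, map_sum, Finset.sum_mul_sum]
  refine Finset.sum_congr rfl fun n _ => Finset.sum_congr rfl fun m _ => ?_
  rw [map_mul (starRingEnd ℂ), Complex.conj_ofReal, ← Circle.coe_inv_eq_conj,
    ← AddChar.map_neg_eq_inv]
  have h : (𝐞 ((n : ℝ) * α) : ℂ) * (𝐞 (-((m : ℝ) * α)) : ℂ) =
      (𝐞 ((((n : ℤ) - m : ℤ) : ℝ) * α) : ℂ) := by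
    rw [← Circle.coe_mul, ← AddChar.map_add_eq_mul]
    congr 2
    push_cast
    ring
  push_cast at h ⊢
  rw [← h]
  ring

/-- Parseval `∫₀¹ |f̂(α)|² dα = ∑_{n ≤ N} f(n)²` (private copy of
`TernaryHolderCounting.integral_norm_sq_expSumOf`, to keep this file independent of that one's build). [folklore] -/
private theorem integral_norm_sq_expSumOf_aux (f : ℕ → ℝ) (N : ℕ) :
    ∫ α in (0 : ℝ)..1, ‖expSumOf f N α‖ ^ 2 = ∑ n ∈ range (N + 1), f n ^ 2 := by
  apply Complex.ofReal_injective
  rw [← intervalIntegral.integral_ofReal]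
  simp_rw [norm_sq_expSumOf_eq_aux]
  have hcont : ∀ (c : ℝ) (k : ℤ), Continuous fun α : ℝ => (c : ℂ) * (𝐞 ((k : ℝ) * α) : ℂ) :=
    fun c k => continuous_const.mul (continuous_subtype_val.comp
      (Real.continuous_fourierChar.comp (continuous_const.mul continuous_id)))
  have horth : ∀ n : ℤ, ∫ α in (0 : ℝ)..1, (𝐞 (n * α) : ℂ) = if n = 0 then 1 else 0 :=
    integral_fourierChar_intCast_holds
  rw [intervalIntegral.integral_finsetSum fun p _ =>
    (continuous_finsetSum _ fun q _ => hcont _ _).intervalIntegrable _ _]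
  simp_rw [intervalIntegral.integral_finsetSum fun q _ => (hcont _ _).intervalIntegrable _ _,
    intervalIntegral.integral_const_mul, horth, sub_eq_zero, Nat.cast_inj]
  push_cast
  refine Finset.sum_congr rfl fun n hn => ?_
  rw [Finset.sum_congr rfl fun x _ => by rw [mul_ite, mul_one, mul_zero], Finset.sum_ite_eq,
    if_pos hn, sq]

/-! ### The majorant principle for fourth moments -/

/-- Additive self-convolution on `[0, N]`: `(f ∗ f)(m) = ∑_{n₁+n₂=m, nᵢ ≤ N} f(n₁) f(n₂)`. [cite: Montgomery1994, Chapter 7 §3 (the majorant principle for even moments of exponential sums)] -/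
def conv (f : ℕ → ℝ) (N m : ℕ) : ℝ :=
  ∑ p ∈ (range (N + 1) ×ˢ range (N + 1)).filter (fun p : ℕ × ℕ => p.1 + p.2 = m), f p.1 * f p.2

/-- `f̂(α)² = (f ∗ f)^(α)`. [folklore] -/
private theorem expSumOf_sq (f : ℕ → ℝ) (N : ℕ) (α : ℝ) :
    expSumOf f N α ^ 2 = expSumOf (conv f N) (2 * N) α := by
  have hmul : ∀ p : ℕ × ℕ, ((f p.1 : ℂ) * (𝐞 ((p.1 : ℝ) * α) : ℂ)) *
      ((f p.2 : ℂ) * (𝐞 ((p.2 : ℝ) * α) : ℂ)) =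
      ((f p.1 * f p.2 : ℝ) : ℂ) * (𝐞 (((p.1 + p.2 : ℕ) : ℝ) * α) : ℂ) := by
    intro p
    have h : (𝐞 ((p.1 : ℝ) * α) : ℂ) * (𝐞 ((p.2 : ℝ) * α) : ℂ) =
        (𝐞 (((p.1 + p.2 : ℕ) : ℝ) * α) : ℂ) := by
      rw [← Circle.coe_mul, ← AddChar.map_add_eq_mul]; congr 2; push_cast; ring
    rw [← h]; push_cast; ring
  have hF : ∀ m ∈ range (2 * N + 1), ∀ p ∈ (range (N + 1) ×ˢ range (N + 1)).filter
      (fun p : ℕ × ℕ => p.1 + p.2 = m),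
      ((f p.1 * f p.2 : ℝ) : ℂ) * (𝐞 ((m : ℝ) * α) : ℂ) =
        ((f p.1 * f p.2 : ℝ) : ℂ) * (𝐞 (((p.1 + p.2 : ℕ) : ℝ) * α) : ℂ) := by
    intro m _ p hp
    rw [(Finset.mem_filter.1 hp).2]
  have hmaps : ∀ p ∈ range (N + 1) ×ˢ range (N + 1), p.1 + p.2 ∈ range (2 * N + 1) := by
    intro p hp
    rw [Finset.mem_product, mem_range, mem_range] at hp
    rw [mem_range]; omega
  calc expSumOf f N α ^ 2
      = ∑ p ∈ range (N + 1) ×ˢ range (N + 1),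
          ((f p.1 : ℂ) * (𝐞 ((p.1 : ℝ) * α) : ℂ)) * ((f p.2 : ℂ) * (𝐞 ((p.2 : ℝ) * α) : ℂ)) := by
        rw [sq, expSumOf, Finset.sum_mul_sum, ← Finset.sum_product']
    _ = ∑ p ∈ range (N + 1) ×ˢ range (N + 1),
          ((f p.1 * f p.2 : ℝ) : ℂ) * (𝐞 (((p.1 + p.2 : ℕ) : ℝ) * α) : ℂ) :=
        Finset.sum_congr rfl fun p _ => hmul p
    _ = ∑ m ∈ range (2 * N + 1), ∑ p ∈ (range (N + 1) ×ˢ range (N + 1)).filter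
          (fun p : ℕ × ℕ => p.1 + p.2 = m),
          ((f p.1 * f p.2 : ℝ) : ℂ) * (𝐞 (((p.1 + p.2 : ℕ) : ℝ) * α) : ℂ) :=
        (Finset.sum_fiberwise_of_maps_to hmaps _).symm
    _ = ∑ m ∈ range (2 * N + 1), ∑ p ∈ (range (N + 1) ×ˢ range (N + 1)).filter
          (fun p : ℕ × ℕ => p.1 + p.2 = m),
          ((f p.1 * f p.2 : ℝ) : ℂ) * (𝐞 ((m : ℝ) * α) : ℂ) :=
        Finset.sum_congr rfl fun m hm => Finset.sum_congr rfl fun p hp => (hF m hm p hp).symm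
    _ = expSumOf (conv f N) (2 * N) α := by
        unfold expSumOf conv
        refine Finset.sum_congr rfl fun m _ => ?_
        rw [Complex.ofReal_sum, Finset.sum_mul]

/-- `∫₀¹ |f̂|⁴ = ∑_m (f ∗ f)(m)²` (Parseval for `f̂²`). [cite: Montgomery1994, Chapter 7 §3 (the majorant principle for even moments of exponential sums)] -/
theorem fourthMoment_eq (f : ℕ → ℝ) (N : ℕ) :
    ∫ α in (0 : ℝ)..1, ‖expSumOf f N α‖ ^ 4 = ∑ m ∈ range (2 * N + 1), conv f N m ^ 2 := by
  have h : ∀ α : ℝ, ‖expSumOf f N α‖ ^ 4 = ‖expSumOf (conv f N) (2 * N) α‖ ^ 2 := by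
    intro α; rw [← expSumOf_sq, norm_pow]; ring
  simp_rw [h]
  exact integral_norm_sq_expSumOf_aux _ _

/-- (private helper) [folklore] -/
private theorem conv_nonneg {f : ℕ → ℝ} (hf : ∀ n, 0 ≤ f n) (N m : ℕ) : 0 ≤ conv f N m :=
  Finset.sum_nonneg fun _ _ => mul_nonneg (hf _) (hf _)

/-- (private helper) [folklore] -/
private theorem conv_mono {f g : ℕ → ℝ} {N : ℕ} (hf : ∀ n, 0 ≤ f n) (hfg : ∀ n, n ≤ N → f n ≤ g n)
    (m : ℕ) : conv f N m ≤ conv g N m := by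
  refine Finset.sum_le_sum fun p hp => ?_
  have hp' := (Finset.mem_filter.1 hp).1
  rw [Finset.mem_product, mem_range, mem_range] at hp'
  exact mul_le_mul (hfg _ (by omega)) (hfg _ (by omega)) (hf _)
    ((hf _).trans (hfg _ (by omega)))

/-- **Majorant principle:** `0 ≤ f ≤ g` on `[0, N]` implies `∫₀¹ |f̂|⁴ ≤ ∫₀¹ |ĝ|⁴`. [cite: Montgomery1994, Chapter 7 §3 (the majorant principle for even moments of exponential sums)] -/
theorem fourthMoment_mono {f g : ℕ → ℝ} {N : ℕ} (hf : ∀ n, 0 ≤ f n)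
    (hfg : ∀ n, n ≤ N → f n ≤ g n) :
    ∫ α in (0 : ℝ)..1, ‖expSumOf f N α‖ ^ 4 ≤ ∫ α in (0 : ℝ)..1, ‖expSumOf g N α‖ ^ 4 := by
  rw [fourthMoment_eq, fourthMoment_eq]
  exact Finset.sum_le_sum fun m _ =>
    pow_le_pow_left₀ (conv_nonneg hf N m) (conv_mono hf hfg m) 2

/-- (private helper) [folklore] -/
private theorem expSumOf_const_mul (K : ℝ) (f : ℕ → ℝ) (N : ℕ) (α : ℝ) :
    expSumOf (fun n => K * f n) N α = K * expSumOf f N α := by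
  unfold expSumOf
  rw [Finset.mul_sum]
  refine Finset.sum_congr rfl fun n _ => ?_
  push_cast; ring

/-! ### The box majorant `r₀` and the factorisation `r̂₀(α) = f(α) f(2α)` -/

/-- `r₀(n) = #{(x, y) ∈ [1, P]² : x³ + 2y³ = n}`. [cite: Vaughan1997, Lemma 2.5 (Hua's lemma) and §2.1 (the generating function of k-th powers)] -/
def boxRep (P n : ℕ) : ℕ := #{xy ∈ Icc 1 P ×ˢ Icc 1 P | xy.1 ^ 3 + 2 * xy.2 ^ 3 = n}

/-- `P = ⌊X(1+η)⌋`. [cite: HeathBrownActa2001, Theorem 1 (the box X < x, y ≤ X(1+η))] -/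
def hbP (c : ℝ) (N : ℕ) : ℕ := ⌊hbX N * (1 + hbEta c N)⌋₊

/-- [cite: HeathBrownActa2001, Theorem 1 (the box X < x, y ≤ X(1+η))] -/
theorem hbRep_le_boxRep (c : ℝ) (N n : ℕ) : hbRep c N n ≤ boxRep (hbP c N) n := by
  unfold hbRep boxRep
  refine Finset.card_le_card fun xy hxy => ?_
  obtain ⟨x, y⟩ := xy
  rw [Finset.mem_filter] at hxy ⊢
  refine ⟨?_, hxy.2⟩
  obtain ⟨hx1, hx2, hy1, hy2, -, -⟩ := (mem_primePairs_iff ..).1 hxy.1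
  have hX := hbX_nonneg N
  have hx0 : 0 < x := by
    have : (0 : ℝ) < x := hX.trans_lt hx1
    exact_mod_cast this
  have hy0 : 0 < y := by
    have : (0 : ℝ) < y := hX.trans_lt hy1
    exact_mod_cast this
  rw [Finset.mem_product, mem_Icc, mem_Icc]
  exact ⟨⟨hx0, Nat.le_floor hx2⟩, hy0, Nat.le_floor hy2⟩

/-- For `3P³ ≤ N`: `∑_{n ≤ N} r₀(n) e(nα) = f(α) f(2α)` with `f = ∑_{x ≤ P} e(x³α)`. [cite: Vaughan1997, Lemma 2.5 (Hua's lemma) and §2.1 (the generating function of k-th powers)] -/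
theorem expSumOf_boxRep {P N : ℕ} (hP : 3 * P ^ 3 ≤ N) (α : ℝ) :
    expSumOf (fun n => (boxRep P n : ℝ)) N α = cubicWeylSum P α * cubicWeylSum P (2 * α) := by
  have hmaps : ∀ xy ∈ Icc 1 P ×ˢ Icc 1 P, xy.1 ^ 3 + 2 * xy.2 ^ 3 ∈ range (N + 1) := by
    intro xy hxy
    rw [Finset.mem_product, mem_Icc, mem_Icc] at hxy
    rw [mem_range]
    have h1 : xy.1 ^ 3 ≤ P ^ 3 := Nat.pow_le_pow_left hxy.1.2 3
    have h2 : xy.2 ^ 3 ≤ P ^ 3 := Nat.pow_le_pow_left hxy.2.2 3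
    omega
  symm
  calc cubicWeylSum P α * cubicWeylSum P (2 * α)
      = ∑ xy ∈ Icc 1 P ×ˢ Icc 1 P,
          (𝐞 ((xy.1 : ℝ) ^ 3 * α) : ℂ) * (𝐞 ((xy.2 : ℝ) ^ 3 * (2 * α)) : ℂ) := by
        rw [cubicWeylSum, cubicWeylSum, Finset.sum_mul_sum, ← Finset.sum_product']
    _ = ∑ xy ∈ Icc 1 P ×ˢ Icc 1 P, (𝐞 (((xy.1 ^ 3 + 2 * xy.2 ^ 3 : ℕ) : ℝ) * α) : ℂ) := by
        refine Finset.sum_congr rfl fun xy _ => ?_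
        rw [← Circle.coe_mul, ← AddChar.map_add_eq_mul]
        congr 2; push_cast; ring
    _ = ∑ n ∈ range (N + 1), ∑ xy ∈ (Icc 1 P ×ˢ Icc 1 P).filter
          (fun xy : ℕ × ℕ => xy.1 ^ 3 + 2 * xy.2 ^ 3 = n), (𝐞 ((n : ℝ) * α) : ℂ) := by
        rw [← Finset.sum_fiberwise_of_maps_to hmaps]
        refine Finset.sum_congr rfl fun n _ => Finset.sum_congr rfl fun xy hxy => ?_
        rw [(Finset.mem_filter.1 hxy).2]
    _ = expSumOf (fun n => (boxRep P n : ℝ)) N α := by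
        unfold expSumOf boxRep
        refine Finset.sum_congr rfl fun n _ => ?_
        rw [Finset.sum_const, nsmul_eq_mul]
        push_cast
        rfl

/-! ### `∫₀¹ |f(α) f(2α)|⁴ ≤ ∫₀¹ |f|⁸` (AM–GM and the doubling identity) -/

/-- (private helper) [folklore] -/
private theorem cubicWeylSum_add_one (P : ℕ) (β : ℝ) : cubicWeylSum P (β + 1) = cubicWeylSum P β := by
  unfold cubicWeylSum
  refine Finset.sum_congr rfl fun x _ => ?_
  have h1 : (𝐞 ((x : ℝ) ^ 3) : ℂ) = 1 := by
    have h := RamanujanSum.fourierChar_intCast ((x : ℤ) ^ 3)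
    push_cast at h
    exact h
  rw [mul_add, mul_one, AddChar.map_add_eq_mul, Circle.coe_mul, h1, mul_one]

/-- (private helper) [folklore] -/
private theorem continuous_cubicWeylSum (P : ℕ) : Continuous (cubicWeylSum P) := by
  unfold cubicWeylSum; fun_prop

/-- The doubling identity `∫₀¹ |f(2α)|^k dα = ∫₀¹ |f(α)|^k dα` (`f` is `1`-periodic). [cite: Vaughan1997, Lemma 2.5 (Hua's lemma) and §2.1 (the generating function of k-th powers)] -/
theorem integral_comp_two_mul (P k : ℕ) :
    ∫ α in (0 : ℝ)..1, ‖cubicWeylSum P (2 * α)‖ ^ k =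
      ∫ α in (0 : ℝ)..1, ‖cubicWeylSum P α‖ ^ k := by
  have hper : Function.Periodic (fun β => ‖cubicWeylSum P β‖ ^ k) 1 := fun β => by
    show ‖cubicWeylSum P (β + 1)‖ ^ k = ‖cubicWeylSum P β‖ ^ k
    rw [cubicWeylSum_add_one]
  have hcont : Continuous (fun β => ‖cubicWeylSum P β‖ ^ k) :=
    (continuous_cubicWeylSum P).norm.pow k
  have h2 : (2 : ℝ) * ∫ α in (0 : ℝ)..1, ‖cubicWeylSum P (2 * α)‖ ^ k =
      ∫ α in (0 : ℝ)..2, ‖cubicWeylSum P α‖ ^ k := by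
    have := intervalIntegral.smul_integral_comp_mul_left
      (f := fun β => ‖cubicWeylSum P β‖ ^ k) (a := 0) (b := 1) (2 : ℝ)
    simpa using this
  have hsplit : (∫ α in (0 : ℝ)..1, ‖cubicWeylSum P α‖ ^ k) +
      ∫ α in (1 : ℝ)..2, ‖cubicWeylSum P α‖ ^ k = ∫ α in (0 : ℝ)..2, ‖cubicWeylSum P α‖ ^ k :=
    intervalIntegral.integral_add_adjacent_intervals (hcont.intervalIntegrable 0 1)
      (hcont.intervalIntegrable 1 2)
  have hshift : ∫ α in (1 : ℝ)..2, ‖cubicWeylSum P α‖ ^ k =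
      ∫ α in (0 : ℝ)..1, ‖cubicWeylSum P α‖ ^ k := by
    have := hper.intervalIntegral_add_eq 1 0
    norm_num at this
    exact this
  linarith [h2, hsplit, hshift]

/-- [cite: Vaughan1997, Lemma 2.5 (Hua's lemma) and §2.1 (the generating function of k-th powers)] -/
theorem integral_norm_mul_pow_four_le (P : ℕ) :
    ∫ α in (0 : ℝ)..1, ‖cubicWeylSum P α * cubicWeylSum P (2 * α)‖ ^ 4 ≤
      ∫ α in (0 : ℝ)..1, ‖cubicWeylSum P α‖ ^ 8 := by
  have hc := continuous_cubicWeylSum P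
  have hc2 : Continuous fun α : ℝ => cubicWeylSum P (2 * α) :=
    hc.comp (continuous_const.mul continuous_id)
  have hle : ∀ α : ℝ, ‖cubicWeylSum P α * cubicWeylSum P (2 * α)‖ ^ 4 ≤
      (‖cubicWeylSum P α‖ ^ 8 + ‖cubicWeylSum P (2 * α)‖ ^ 8) / 2 := by
    intro α
    rw [norm_mul, mul_pow]
    nlinarith [sq_nonneg (‖cubicWeylSum P α‖ ^ 4 - ‖cubicWeylSum P (2 * α)‖ ^ 4)]
  have hi1 : IntervalIntegrable (fun α : ℝ => ‖cubicWeylSum P α * cubicWeylSum P (2 * α)‖ ^ 4)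
      volume 0 1 := ((hc.mul hc2).norm.pow 4).intervalIntegrable 0 1
  have hi8 : IntervalIntegrable (fun α : ℝ => ‖cubicWeylSum P α‖ ^ 8) volume 0 1 :=
    (hc.norm.pow 8).intervalIntegrable 0 1
  have hi8' : IntervalIntegrable (fun α : ℝ => ‖cubicWeylSum P (2 * α)‖ ^ 8) volume 0 1 :=
    (hc2.norm.pow 8).intervalIntegrable 0 1
  calc ∫ α in (0 : ℝ)..1, ‖cubicWeylSum P α * cubicWeylSum P (2 * α)‖ ^ 4
      ≤ ∫ α in (0 : ℝ)..1, (‖cubicWeylSum P α‖ ^ 8 + ‖cubicWeylSum P (2 * α)‖ ^ 8) / 2 :=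
        intervalIntegral.integral_mono_on zero_le_one hi1 ((hi8.add hi8').div_const 2)
          fun α _ => hle α
    _ = ((∫ α in (0 : ℝ)..1, ‖cubicWeylSum P α‖ ^ 8) +
          ∫ α in (0 : ℝ)..1, ‖cubicWeylSum P (2 * α)‖ ^ 8) / 2 := by
        rw [intervalIntegral.integral_div, intervalIntegral.integral_add hi8 hi8']
    _ = ∫ α in (0 : ℝ)..1, ‖cubicWeylSum P α‖ ^ 8 := by
        rw [integral_comp_two_mul]; ring

/-! ### E4b ⇐ E4a -/

/-- **E4 reduction PROVED:** Hua's eighth-moment lemma with logs implies the fourth-moment bound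
for `f̂₃`, with `C ↦ C⁺ + 4`. [cite: Vaughan1997, Lemma 2.5 (Hua's lemma) and §2.1 (the generating function of k-th powers)] -/
theorem hbFourthMomentReduction_holds : HBFourthMomentReduction := by
  rintro ⟨C, cH, hcH, hHua⟩ c hc
  have hev1 : ∀ᶠ N : ℕ in atTop, hbEta c N ≤ 1 / 10 :=
    ((tendsto_hbEta hc).eventually (gt_mem_nhds (by norm_num : (0 : ℝ) < 1 / 10))).mono
      fun N h => h.le
  have hev2 : ∀ᶠ N : ℕ in atTop, (3 : ℝ) ≤ hbX N := tendsto_hbX.eventually_ge_atTop 3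
  obtain ⟨N₀, hN₀⟩ := Filter.eventually_atTop.1 (hev1.and (hev2.and (eventually_gt_atTop 6)))
  have hI0 : ∀ n : ℕ, 0 ≤ ∫ α in (0 : ℝ)..1, ‖hbExpSum c n α‖ ^ 4 := fun n =>
    intervalIntegral.integral_nonneg zero_le_one fun α _ => by positivity
  have hterm0 : ∀ n : ℕ, 0 ≤ (∫ α in (0 : ℝ)..1, ‖hbExpSum c n α‖ ^ 4) /
      ((n : ℝ) ^ 3 * Real.log n ^ (max C 0 + 4)) := fun n =>
    div_nonneg (hI0 n) (mul_nonneg (by positivity) (Real.rpow_nonneg (Real.log_natCast_nonneg n) _))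
  refine ⟨max C 0 + 4, cH + ∑ n ∈ range N₀, (∫ α in (0 : ℝ)..1, ‖hbExpSum c n α‖ ^ 4) /
      ((n : ℝ) ^ 3 * Real.log n ^ (max C 0 + 4)), fun N hN3 => ?_⟩
  have hM0 : 0 ≤ ∑ n ∈ range N₀, (∫ α in (0 : ℝ)..1, ‖hbExpSum c n α‖ ^ 4) /
      ((n : ℝ) ^ 3 * Real.log n ^ (max C 0 + 4)) := Finset.sum_nonneg fun n _ => hterm0 n
  have hN0 : (0 : ℝ) < N := by exact_mod_cast (show 0 < N by omega)
  have hL0 : 0 < Real.log N := Real.log_pos (by exact_mod_cast (show 1 < N by omega))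
  have hD0 : 0 < (N : ℝ) ^ 3 * Real.log N ^ (max C 0 + 4) := by positivity
  rcases lt_or_ge N N₀ with hlt | hge
  · -- small `N`: absorbed in the constant
    have hle : (∫ α in (0 : ℝ)..1, ‖hbExpSum c N α‖ ^ 4) /
        ((N : ℝ) ^ 3 * Real.log N ^ (max C 0 + 4)) ≤
        ∑ n ∈ range N₀, (∫ α in (0 : ℝ)..1, ‖hbExpSum c n α‖ ^ 4) /
          ((n : ℝ) ^ 3 * Real.log n ^ (max C 0 + 4)) :=
      Finset.single_le_sum (f := fun n : ℕ => (∫ α in (0 : ℝ)..1, ‖hbExpSum c n α‖ ^ 4) /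
        ((n : ℝ) ^ 3 * Real.log n ^ (max C 0 + 4))) (fun n _ => hterm0 n) (mem_range.2 hlt)
    have h1 := (div_le_iff₀ hD0).1 hle
    have h2 := mul_nonneg hcH.le hD0.le
    linarith
  · -- large `N`: the real argument
    obtain ⟨hη, hX3, hN6⟩ := hN₀ N hge
    obtain ⟨hX1, hLX, hLXle⟩ := hbX_facts hN6
    have hη0 : 0 ≤ hbEta c N := Real.rpow_nonneg hLX.le _
    have hX0 := hbX_nonneg N
    have hPle : (hbP c N : ℝ) ≤ hbX N * (11 / 10) :=
      (Nat.floor_le (mul_nonneg hX0 (by linarith))).trans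
        (mul_le_mul_of_nonneg_left (by linarith) hX0)
    have hP3 : (3 : ℝ) ≤ hbP c N := by
      have h : ((3 : ℕ) : ℝ) ≤ hbX N * (1 + hbEta c N) := by
        push_cast; nlinarith
      exact_mod_cast (Nat.le_floor h : 3 ≤ hbP c N)
    have hP0 : (0 : ℝ) < hbP c N := by linarith
    have hcube : ((N : ℝ) ^ ((1 : ℝ) / 3)) ^ 3 = N := by
      rw [← Real.rpow_natCast, ← Real.rpow_mul hN0.le]; norm_num
    have hN13 : 0 ≤ (N : ℝ) ^ ((1 : ℝ) / 3) := by positivity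
    have hPN : (hbP c N : ℝ) ≤ (N : ℝ) ^ ((1 : ℝ) / 3) := by
      refine hPle.trans ?_
      by_contra h
      rw [not_le] at h
      have hlt3 : ((N : ℝ) ^ ((1 : ℝ) / 3)) ^ 3 < (hbX N * (11 / 10)) ^ 3 := by gcongr
      rw [hcube, mul_pow, hbX_pow_three] at hlt3
      norm_num at hlt3
      linarith
    have hvals : 3 * hbP c N ^ 3 ≤ N := by
      have h1 : (hbP c N : ℝ) ^ 3 ≤ (hbX N * (11 / 10)) ^ 3 := by gcongr
      rw [mul_pow, hbX_pow_three] at h1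
      norm_num at h1
      have h : (3 : ℝ) * (hbP c N : ℝ) ^ 3 ≤ N := by linarith
      exact_mod_cast h
    have hK0 : 0 ≤ (N : ℝ) ^ ((1 : ℝ) / 3) * Real.log N := by positivity
    -- majorant
    have hmono : ∫ α in (0 : ℝ)..1, ‖hbExpSum c N α‖ ^ 4 ≤
        ∫ α in (0 : ℝ)..1, ‖expSumOf (fun n => (N : ℝ) ^ ((1 : ℝ) / 3) * Real.log N *
          (boxRep (hbP c N) n : ℝ)) N α‖ ^ 4 := by
      simp_rw [← expSumOf_hbWeight]
      refine fourthMoment_mono (hbWeight_nonneg c N) fun n hn => ?_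
      unfold hbWeight
      exact mul_le_mul (mul_le_mul_of_nonneg_left (log_natCast_le_of_le hn) hN13)
        (by exact_mod_cast hbRep_le_boxRep c N n) (Nat.cast_nonneg _) hK0
    have hscal : ∀ α : ℝ, ‖expSumOf (fun n => (N : ℝ) ^ ((1 : ℝ) / 3) * Real.log N *
        (boxRep (hbP c N) n : ℝ)) N α‖ ^ 4 =
        ((N : ℝ) ^ ((1 : ℝ) / 3) * Real.log N) ^ 4 *
          ‖cubicWeylSum (hbP c N) α * cubicWeylSum (hbP c N) (2 * α)‖ ^ 4 := by
      intro α
      rw [expSumOf_const_mul, ← expSumOf_boxRep hvals, norm_mul, mul_pow, Complex.norm_real,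
        Real.norm_of_nonneg hK0]
    have hHuaN := hHua (hbP c N) (by exact_mod_cast (show (2 : ℝ) ≤ hbP c N by linarith))
    have hLP1 : 1 ≤ Real.log (hbP c N) := by
      rw [Real.le_log_iff_exp_le hP0]
      have := Real.exp_one_lt_d9
      linarith
    have hLP : Real.log (hbP c N) ≤ Real.log N := by
      refine Real.log_le_log hP0 (hPN.trans ?_)
      have h : (N : ℝ) ^ ((1 : ℝ) / 3) ≤ (N : ℝ) ^ (1 : ℝ) :=
        Real.rpow_le_rpow_of_exponent_le (by exact_mod_cast (show 1 ≤ N by omega)) (by norm_num)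
      rwa [Real.rpow_one] at h
    have hlogC : Real.log (hbP c N) ^ C ≤ Real.log N ^ (max C 0) :=
      (Real.rpow_le_rpow_of_exponent_le hLP1 (le_max_left C 0)).trans
        (Real.rpow_le_rpow (by linarith) hLP (le_max_right C 0))
    have hP5 : (hbP c N : ℝ) ^ 5 ≤ ((N : ℝ) ^ ((1 : ℝ) / 3)) ^ 5 := by gcongr
    have hchain : ∫ α in (0 : ℝ)..1, ‖hbExpSum c N α‖ ^ 4 ≤
        cH * (N : ℝ) ^ 3 * Real.log N ^ (max C 0 + 4) := by
      calc ∫ α in (0 : ℝ)..1, ‖hbExpSum c N α‖ ^ 4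
          ≤ ∫ α in (0 : ℝ)..1, ‖expSumOf (fun n => (N : ℝ) ^ ((1 : ℝ) / 3) * Real.log N *
              (boxRep (hbP c N) n : ℝ)) N α‖ ^ 4 := hmono
        _ = ((N : ℝ) ^ ((1 : ℝ) / 3) * Real.log N) ^ 4 *
              ∫ α in (0 : ℝ)..1, ‖cubicWeylSum (hbP c N) α * cubicWeylSum (hbP c N) (2 * α)‖ ^ 4 := by
            simp_rw [hscal]
            exact intervalIntegral.integral_const_mul _ _
        _ ≤ ((N : ℝ) ^ ((1 : ℝ) / 3) * Real.log N) ^ 4 *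
              ∫ α in (0 : ℝ)..1, ‖cubicWeylSum (hbP c N) α‖ ^ 8 :=
            mul_le_mul_of_nonneg_left (integral_norm_mul_pow_four_le _) (by positivity)
        _ ≤ ((N : ℝ) ^ ((1 : ℝ) / 3) * Real.log N) ^ 4 *
              (cH * (hbP c N : ℝ) ^ 5 * Real.log (hbP c N) ^ C) :=
            mul_le_mul_of_nonneg_left hHuaN (by positivity)
        _ ≤ ((N : ℝ) ^ ((1 : ℝ) / 3) * Real.log N) ^ 4 *
              (cH * ((N : ℝ) ^ ((1 : ℝ) / 3)) ^ 5 * Real.log N ^ (max C 0)) :=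
            mul_le_mul_of_nonneg_left (mul_le_mul (mul_le_mul_of_nonneg_left hP5 hcH.le) hlogC
              (Real.rpow_nonneg (by linarith) _) (by positivity)) (by positivity)
        _ = cH * (N : ℝ) ^ 3 * Real.log N ^ (max C 0 + 4) := by
            rw [Real.rpow_add hL0, show Real.log N ^ (4 : ℝ) = Real.log N ^ (4 : ℕ) by
              exact_mod_cast Real.rpow_natCast _ 4]
            have h9 : ((N : ℝ) ^ ((1 : ℝ) / 3)) ^ 9 = (N : ℝ) ^ 3 := by
              rw [show ((N : ℝ) ^ ((1 : ℝ) / 3)) ^ 9 = (((N : ℝ) ^ ((1 : ℝ) / 3)) ^ 3) ^ 3 by ring,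
                hcube]
            rw [← h9]; ring
    have h2 := mul_nonneg hM0 hD0.le
    linarith

/-- **E4b, unconditionally**: the `L⁴` bound for the Heath-Brown weight, from the tree's Hua lemma with
logarithmic loss (`HuaCubes.huaEighthMomentLog_holds`). [cite: Vaughan1997, Lemma 2.5 (Hua's lemma) and §2.1 (the generating function of k-th powers)] -/
theorem hbFourierFourthMoment_holds : HBFourierFourthMoment :=
  hbFourthMomentReduction_holds huaEighthMomentLog_holds

/-! ### The integer side of the box tends to infinity

Appended 2026-08-27 (parity-ideate lit g13): `Xη = X(log X)^{−c} → ∞` and hence the integer side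
`⌊X(1+η)⌋ − ⌊X⌋ ≥ Xη − 1` of Heath-Brown's box (`hbSide` of `HeathBrownWeightClassSums.lean`, stated
here without that import) tends to infinity — the hypothesis `L/d ≥ L₀` of the class sieves
(`CubicFormClassBrunTitchmarsh`, `HeathBrownWeightClassSums`) for every fixed modulus `d`. -/

/-- `Xη = X (log X)^{−c} → ∞` (any real `c`; `(log X)^c = o(X^{1/2})`).
[cite: HeathBrownActa2001, Theorem 1 (the box X < x, y ≤ X(1+η) with η = (log X)^{-c})] -/
theorem tendsto_hbX_mul_hbEta_atTop (c : ℝ) :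
    Tendsto (fun N : ℕ => hbX N * hbEta c N) atTop atTop := by
  -- `x (log x)^{-c} ≥ x^{1/2}` eventually, since `(log x)^c ≤ x^{1/2}` eventually
  have hlo : ∀ᶠ x : ℝ in atTop, ‖Real.log x ^ c‖ ≤ 1 * ‖x ^ (1 / 2 : ℝ)‖ :=
    (isLittleO_log_rpow_rpow_atTop c (by norm_num : (0 : ℝ) < 1 / 2)).bound one_pos
  have hev : ∀ᶠ x : ℝ in atTop, x ^ (1 / 2 : ℝ) ≤ x * Real.log x ^ (-c) := by
    filter_upwards [hlo, eventually_gt_atTop (1 : ℝ)] with x hx hx1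
    have hlogpos : 0 < Real.log x := Real.log_pos hx1
    have hLc : 0 < Real.log x ^ c := Real.rpow_pos_of_pos hlogpos c
    rw [one_mul, Real.norm_of_nonneg hLc.le, Real.norm_of_nonneg (Real.rpow_nonneg (by linarith) _)] at hx
    rw [Real.rpow_neg hlogpos.le, ← div_eq_mul_inv, le_div_iff₀ hLc]
    -- `x^{1/2} (log x)^c ≤ x^{1/2} x^{1/2} = x`
    have hxhalf : 0 ≤ x ^ (1 / 2 : ℝ) := Real.rpow_nonneg (by linarith) _
    calc x ^ (1 / 2 : ℝ) * Real.log x ^ c ≤ x ^ (1 / 2 : ℝ) * x ^ (1 / 2 : ℝ) :=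
          mul_le_mul_of_nonneg_left hx hxhalf
      _ = x := by
          rw [← Real.rpow_add (by linarith)]
          norm_num
  have hsqrt : Tendsto (fun x : ℝ => x ^ (1 / 2 : ℝ)) atTop atTop :=
    tendsto_rpow_atTop (by norm_num)
  have hreal : Tendsto (fun x : ℝ => x * Real.log x ^ (-c)) atTop atTop :=
    tendsto_atTop_mono' atTop hev hsqrt
  have h := hreal.comp tendsto_hbX
  refine h.congr fun N => ?_
  simp only [Function.comp, hbEta]

/-- **The integer side of Heath-Brown's box tends to infinity**: `⌊X(1+η)⌋ − ⌊X⌋ → ∞` (it is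
`≥ Xη − 1`). [cite: HeathBrownActa2001, Theorem 1 (the box X < x, y ≤ X(1+η) with η = (log X)^{-c})] -/
theorem tendsto_hbBoxSide_atTop (c : ℝ) :
    Tendsto (fun N : ℕ => ((⌊hbX N * (1 + hbEta c N)⌋₊ - ⌊hbX N⌋₊ : ℕ) : ℝ)) atTop atTop := by
  have hmain := tendsto_hbX_mul_hbEta_atTop c
  -- eventually `Xη ≥ 0`, hence `η ≥ 0` (or `X = 0`), and then `side ≥ Xη − 1`
  have hev : ∀ᶠ N : ℕ in atTop,
      hbX N * hbEta c N - 1 ≤ ((⌊hbX N * (1 + hbEta c N)⌋₊ - ⌊hbX N⌋₊ : ℕ) : ℝ) := by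
    filter_upwards [hmain.eventually_ge_atTop 0] with N hN
    have hX := hbX_nonneg N
    have hη0 : 0 ≤ hbEta c N := by
      rcases hX.eq_or_lt with h | h
      · -- `X = 0`: then `log X = 0` and `η = 0 ^ (−c) ≥ 0`
        unfold hbEta
        rw [← h, Real.log_zero]
        exact Real.rpow_nonneg le_rfl _
      · nlinarith
    have hY : hbX N ≤ hbX N * (1 + hbEta c N) := by nlinarith
    have hAM : ⌊hbX N⌋₊ ≤ ⌊hbX N * (1 + hbEta c N)⌋₊ := Nat.floor_le_floor hY
    rw [Nat.cast_sub hAM]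
    have h1 : hbX N * (1 + hbEta c N) - 1 < (⌊hbX N * (1 + hbEta c N)⌋₊ : ℝ) := Nat.sub_one_lt_floor _
    have h2 : (⌊hbX N⌋₊ : ℝ) ≤ hbX N := Nat.floor_le hX
    linarith
  refine tendsto_atTop_mono' atTop hev ?_
  exact tendsto_atTop_add_const_right atTop (-1) hmain |>.congr fun N => by ring

/-- **Eventually every value on the box is `≤ N`**: `3⌊X(1+η)⌋³ ≤ N` for all large `N` (`c > 0`),
since `η → 0` makes `(1+η)³ ≤ 2` and `X³ = N/6`; so `x³ + 2y³ ≤ 3⌊X(1+η)⌋³ ≤ N < n` for the box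
pairs and `n > N`. [cite: HeathBrownActa2001, Theorem 1 (the box X < x, y ≤ X(1+η): its values lie in (X³, 3X³(1+η)³])] -/
theorem eventually_three_mul_floor_cube_le {c : ℝ} (hc : 0 < c) :
    ∀ᶠ N : ℕ in atTop, 3 * ((⌊hbX N * (1 + hbEta c N)⌋₊ : ℕ) : ℝ) ^ 3 ≤ N := by
  have hη := tendsto_hbEta hc
  have hev₁ : ∀ᶠ N : ℕ in atTop, hbEta c N < 1 / 4 := hη.eventually_lt_const (by norm_num)
  have hev₂ : ∀ᶠ N : ℕ in atTop, (-1 : ℝ) < hbEta c N := hη.eventually_const_lt (by norm_num)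
  filter_upwards [hev₁, hev₂] with N h1 h2
  have hX := hbX_nonneg N
  have h1η0 : 0 ≤ 1 + hbEta c N := by linarith
  have hY0 : 0 ≤ hbX N * (1 + hbEta c N) := mul_nonneg hX h1η0
  have hfl : ((⌊hbX N * (1 + hbEta c N)⌋₊ : ℕ) : ℝ) ≤ hbX N * (1 + hbEta c N) := Nat.floor_le hY0
  have hfl0 : (0 : ℝ) ≤ ((⌊hbX N * (1 + hbEta c N)⌋₊ : ℕ) : ℝ) := Nat.cast_nonneg _
  have hcube : ((⌊hbX N * (1 + hbEta c N)⌋₊ : ℕ) : ℝ) ^ 3 ≤ (hbX N * (1 + hbEta c N)) ^ 3 :=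
    pow_le_pow_left₀ hfl0 hfl 3
  have h1η : (1 + hbEta c N) ^ 3 ≤ (5 / 4 : ℝ) ^ 3 := pow_le_pow_left₀ h1η0 (by linarith) 3
  have hX3 := hbX_pow_three N
  have hN0 : (0 : ℝ) ≤ N := Nat.cast_nonneg N
  calc 3 * ((⌊hbX N * (1 + hbEta c N)⌋₊ : ℕ) : ℝ) ^ 3 ≤ 3 * (hbX N * (1 + hbEta c N)) ^ 3 := by
        linarith
    _ = 3 * (hbX N ^ 3 * (1 + hbEta c N) ^ 3) := by ring
    _ ≤ 3 * ((N : ℝ) / 6 * (5 / 4 : ℝ) ^ 3) := by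
        rw [hX3]
        exact mul_le_mul_of_nonneg_left (mul_le_mul_of_nonneg_left h1η (by positivity)) (by norm_num)
    _ ≤ N := by nlinarith

end Literature.NumberTheory.Sieve.CubicMinorant

end

/-! ## `_holds` aliases (appended 2026-08-28)

The named fact(s) below are already theorems of the tree under a differently-cased `_holds` name; the exact-name `_holds`
alias records the discharge under the tree's naming convention (D-0026 bookkeeping: proof term =
the existing theorem, no statement or definition edited). -/

/-- `HBFourthMomentReduction` is a theorem of the tree (`Literature.NumberTheory.Sieve.CubicMinorant.hbFourthMomentReduction_holds`). [cite: Montgomery1994, Chapter 7 §3 (the majorant principle for even moments of exponential sums)] -/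
theorem _root_.Literature.NumberTheory.Sieve.CubicMinorant.HBFourthMomentReduction_holds : _root_.Literature.NumberTheory.Sieve.CubicMinorant.HBFourthMomentReduction :=
  _root_.Literature.NumberTheory.Sieve.CubicMinorant.hbFourthMomentReduction_holds

/-- `HBFourierFourthMoment` is a theorem of the tree (`Literature.NumberTheory.Sieve.CubicMinorant.hbFourierFourthMoment_holds`). [cite: Vaughan1997, Lemma 2.5 (Hua's lemma) and §2.1 (the generating function of k-th powers)] -/
theorem _root_.Literature.NumberTheory.Sieve.CubicMinorant.HBFourierFourthMoment_holds : _root_.Literature.NumberTheory.Sieve.CubicMinorant.HBFourierFourthMoment :=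
  _root_.Literature.NumberTheory.Sieve.CubicMinorant.hbFourierFourthMoment_holds
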